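import Literature.NumberTheory.Sieve.BombieriFriedlanderIwaniecTheorem9Dyadic
import Literature.NumberTheory.Sieve.BombieriFriedlanderIwaniecTheorem7StarSwitchHarmonic
import Literature.NumberTheory.Sieve.BombieriFriedlanderIwaniecTheorem7StarSwitch
import HarnessLib

/-!
# BFI 1986, Theorem 9 — the `q ↔ s` switch at the level of `Λ`, I: counting lemmas

Topic `Literature/NumberTheory/Sieve`.  E. Bombieri, J. B. Friedlander, H. Iwaniec, *Primes in
arithmetic progressions to large moduli*, Acta Math. 156 (1986), 203–251, prove Theorem 6 (§13)
under the standing assumption (13.1) `Q²R ≤ x`, reducing the complementary moduli to it by the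
symmetry `q ↔ s` of the equation `mn = a + qrs` (p. 241: "Since both `q` and `s` are counted with
weight 1 … they appear symmetrically in `𝒟` except that `s` runs through an interval dependent on
`m, n, r`.  By a subdivision argument we remove this dependence with an admissible error term,
since `s ∼ S = x/QR > ℒ^B`, this lower bound being crucial to the argument").  For the abstract
coefficients of Theorem 6 that reduction is not available (audit in `…Theorem6Core`); in the
re-threading of Theorem 9 through the core case (`…Theorem9CoreCaseI`) the same symmetry is applied
to the explicit sums of Theorem 9, `∑_{q} ∑_{n ≡ a (qr)} Λ(n)` — Dirichlet's hyperbola method, as in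
the later treatments of the Titchmarsh divisor problem (É. Fouvry, J. reine angew. Math. 357 (1985),
§VII; S. Drappeau, Proc. Lond. Math. Soc. 114 (2017), remark after Thm 6.2).  This file has the
counting lemmas of that switch, all PROVED (no named fact is introduced):

* `BFI.card_Ioc_floor_filter_dvd_eq_card_switch` — for `K ≥ 1` and real `0 ≤ P ≤ P'`, the divisors
  `q ∈ (P, P']` of `K` are in bijection with the divisors `s = K/q` with `Ps < K ≤ P's`;
  `BFI.sum_Ioc_floor_dvd_indicator_eq` — the same with the modulus `qr`, as sums of indicators;
* `BFI.switch_sum_eq` — **the switch for a weighted sum**: for any weight `w` and any condition on `n`,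
  `∑_{P<q≤P'} ∑_{n, qr ∣ n−a} w(n) = ∑_{s ≤ S} ∑_{n, sr ∣ n−a, Prs < n−a ≤ P'rs} w(n)` (`n > a`, `n − a ≤ S`);
* `BFI.card_Ioc_filter_intCast_dvd_sub_le/ge` — `#{A < n ≤ B : d ∣ n − a} = (B − A)/d + O(1)`;
* `BFI.sum_Icc_floor_eq_sum_geomBlocks` — `[1, X] = ⨆_{i<M} (Xλ^{−(i+1)}, Xλ^{−i}]` for `λ > 1`,
  `Xλ^{−M} < 1` (the subdivision into blocks of ratio `λ = 1 + η`), with the block-count bound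
  `BFI.exists_geomBlocks`.

## References

* E. Bombieri, J. B. Friedlander, H. Iwaniec, Acta Math. 156 (1986), 203–251, §13 p. 241–242;
  §16 p. 250. [BombieriFriedlanderIwaniecActa1986]
-/

open Finset Real

namespace Literature.NumberTheory.Sieve

namespace BFI

/-! ### The bijection `q ↦ K/q` with real endpoints -/

/-- For `K ≥ 1` and real `0 ≤ P ≤ P'`: the divisors `q ∈ (P, P']` of `K` (i.e. `⌊P⌋ < q ≤ ⌊P'⌋`) are
in bijection with the divisors `s` of `K` with `P s < K ≤ P' s` (`s = K/q`).
[cite: BombieriFriedlanderIwaniecActa1986, §13 p. 241–242] -/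
theorem card_Ioc_floor_filter_dvd_eq_card_switch {K : ℕ} (hK : K ≠ 0) {P P' : ℝ} (hP : 0 ≤ P) :
    ((Ioc ⌊P⌋₊ ⌊P'⌋₊).filter (fun q : ℕ => q ∣ K)).card =
      (K.divisors.filter (fun s : ℕ => P * s < K ∧ (K : ℝ) ≤ P' * s)).card := by
  -- `⌊P⌋ < q ↔ P < q` and `q ≤ ⌊P'⌋ ↔ q ≤ P'` for naturals `q ≥ 1`
  have hmemq : ∀ q : ℕ, q ∈ Ioc ⌊P⌋₊ ⌊P'⌋₊ ↔ P < q ∧ (q : ℝ) ≤ P' := by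
    intro q
    rw [Finset.mem_Ioc]
    constructor
    · rintro ⟨h1, h2⟩
      have hq1 : 1 ≤ q := by omega
      refine ⟨Nat.lt_of_floor_lt h1, ?_⟩
      have hP'0 : 0 ≤ P' ∨ P' < 0 := le_or_gt 0 P'
      rcases hP'0 with hP'0 | hP'0
      · exact (Nat.le_floor_iff hP'0).1 h2
      · exfalso
        have : ⌊P'⌋₊ = 0 := Nat.floor_eq_zero.2 (by linarith)
        omega
    · rintro ⟨h1, h2⟩
      have hq0 : (0 : ℝ) < q := hP.trans_lt h1
      have hP'0 : 0 ≤ P' := hq0.le.trans h2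
      exact ⟨(Nat.floor_lt hP).2 h1, Nat.le_floor h2⟩
  refine Finset.card_bij (fun q _ => K / q) (fun q hq => ?_) (fun q₁ hq₁ q₂ hq₂ h => ?_) (fun s hs => ?_)
  · -- maps into
    rw [Finset.mem_filter] at hq
    obtain ⟨hqI, ⟨t, ht⟩⟩ := hq
    obtain ⟨hPq, hqP'⟩ := (hmemq q).1 hqI
    have hq0 : 0 < q := by
      rcases Nat.eq_zero_or_pos q with h | h
      · subst h; simp at ht; exact absurd ht hK
      · exact h
    have hq0r : (0 : ℝ) < q := by exact_mod_cast hq0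
    have hKq : K / q = t := by rw [ht, Nat.mul_div_cancel_left t hq0]
    rw [Finset.mem_filter, Nat.mem_divisors, hKq]
    have hKr : (K : ℝ) = q * t := by rw [ht]; push_cast; ring
    have ht0 : (0 : ℝ) ≤ t := Nat.cast_nonneg _
    refine ⟨⟨⟨q, by rw [ht, mul_comm]⟩, hK⟩, ?_, ?_⟩
    · rw [hKr]
      have ht0' : (0 : ℝ) < t := by
        rcases Nat.eq_zero_or_pos t with h | h
        · subst h; simp at ht; exact absurd ht hK
        · exact_mod_cast h
      exact mul_lt_mul_of_pos_right hPq ht0'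
    · rw [hKr]; exact mul_le_mul_of_nonneg_right hqP' ht0
  · -- injective
    rw [Finset.mem_filter] at hq₁ hq₂
    obtain ⟨t₁, ht₁⟩ := hq₁.2
    obtain ⟨t₂, ht₂⟩ := hq₂.2
    have h1 : 0 < q₁ := by have := (Finset.mem_Ioc.1 hq₁.1).1; omega
    have h2 : 0 < q₂ := by have := (Finset.mem_Ioc.1 hq₂.1).1; omega
    have e1 : K / q₁ = t₁ := by rw [ht₁, Nat.mul_div_cancel_left t₁ h1]
    have e2 : K / q₂ = t₂ := by rw [ht₂, Nat.mul_div_cancel_left t₂ h2]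
    simp only [e1, e2] at h
    have ht0 : 0 < t₁ := Nat.pos_of_ne_zero (by rintro rfl; simp [ht₁] at hK)
    apply Nat.eq_of_mul_eq_mul_right ht0
    rw [← ht₁, h, ← ht₂]
  · -- surjective
    rw [Finset.mem_filter, Nat.mem_divisors] at hs
    obtain ⟨⟨⟨q, hq⟩, -⟩, hs1, hs2⟩ := hs
    have hs0 : 0 < s := Nat.pos_of_ne_zero (by rintro rfl; simp [hq] at hK)
    have hs0r : (0 : ℝ) < s := by exact_mod_cast hs0
    have hKr : (K : ℝ) = s * q := by rw [hq]; push_cast; ring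
    refine ⟨q, ?_, ?_⟩
    · rw [Finset.mem_filter, hmemq]
      refine ⟨⟨?_, ?_⟩, ⟨s, by rw [hq, mul_comm]⟩⟩
      · -- `P < q` from `P s < K = s q`
        by_contra h
        push Not at h
        have : (K : ℝ) ≤ P * s := by
          rw [hKr]; nlinarith
        linarith
      · by_contra h
        push Not at h
        have : P' * s < K := by rw [hKr]; nlinarith
        linarith
    · have hq0 : 0 < q := Nat.pos_of_ne_zero (by rintro rfl; simp [hq] at hK)
      rw [hq, Nat.mul_div_cancel _ hq0]

/-- **The switch as an identity of indicator sums** (modulus `qr ↔ rs`): for an integer `K ≥ 1`,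
`r ≥ 1`, real `0 ≤ P ≤ P'` and `S ≥ K`,
`∑_{⌊P⌋ < q ≤ ⌊P'⌋} 1_{(qr) ∣ K} = ∑_{s ≤ S} 1_{(sr) ∣ K ∧ P r s < K ≤ P' r s}`.
[cite: BombieriFriedlanderIwaniecActa1986, §13 p. 241–242] -/
theorem sum_Ioc_floor_dvd_indicator_eq {K : ℤ} (hK : 0 < K) {r : ℕ} (hr : 0 < r) {P P' : ℝ}
    (hP : 0 ≤ P) {S : ℕ} (hS : K ≤ S) :
    ∑ q ∈ Ioc ⌊P⌋₊ ⌊P'⌋₊, (if ((q * r : ℕ) : ℤ) ∣ K then (1 : ℝ) else 0) =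
      ∑ s ∈ Icc 1 S, (if ((s * r : ℕ) : ℤ) ∣ K ∧ P * r * s < (K : ℝ) ∧ (K : ℝ) ≤ P' * r * s
        then (1 : ℝ) else 0) := by
  rw [← Finset.sum_filter, ← Finset.sum_filter, Finset.sum_const, Finset.sum_const, nsmul_eq_mul,
    nsmul_eq_mul, mul_one, mul_one]
  congr 1
  lift K to ℕ using hK.le
  have hK0 : K ≠ 0 := by exact_mod_cast hK.ne'
  have hrr : (0 : ℝ) < r := by exact_mod_cast hr
  by_cases hrK : r ∣ K
  · obtain ⟨K₁, rfl⟩ := hrK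
    have hK₁ : K₁ ≠ 0 := by rintro rfl; simp at hK0
    have hL : (Ioc ⌊P⌋₊ ⌊P'⌋₊).filter (fun q : ℕ => ((q * r : ℕ) : ℤ) ∣ ((r * K₁ : ℕ) : ℤ)) =
        (Ioc ⌊P⌋₊ ⌊P'⌋₊).filter (fun q : ℕ => q ∣ K₁) := by
      refine Finset.filter_congr fun q _ => ?_
      rw [Int.natCast_dvd_natCast, mul_comm q r]
      exact Nat.mul_dvd_mul_iff_left hr
    have hR : (Icc 1 S).filter (fun s : ℕ => ((s * r : ℕ) : ℤ) ∣ ((r * K₁ : ℕ) : ℤ) ∧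
          P * r * s < (((r * K₁ : ℕ) : ℤ) : ℝ) ∧ (((r * K₁ : ℕ) : ℤ) : ℝ) ≤ P' * r * s) =
        K₁.divisors.filter (fun s : ℕ => P * s < K₁ ∧ (K₁ : ℝ) ≤ P' * s) := by
      ext s
      simp only [Finset.mem_filter, Finset.mem_Icc, Nat.mem_divisors]
      rw [Int.natCast_dvd_natCast]
      have hcast : (((r * K₁ : ℕ) : ℤ) : ℝ) = (r : ℝ) * K₁ := by push_cast; ring
      rw [hcast]
      constructor
      · rintro ⟨⟨hs1, -⟩, hdvd, h1, h2⟩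
        refine ⟨⟨?_, hK₁⟩, ?_, ?_⟩
        · rw [mul_comm s r] at hdvd; exact (Nat.mul_dvd_mul_iff_left hr).1 hdvd
        · have : (r : ℝ) * (P * s) < r * K₁ := by nlinarith
          exact lt_of_mul_lt_mul_left this hrr.le
        · have : (r : ℝ) * K₁ ≤ r * (P' * s) := by nlinarith
          exact le_of_mul_le_mul_left this hrr
      · rintro ⟨⟨hdvd, -⟩, h1, h2⟩
        have hs0 : 0 < s := Nat.pos_of_ne_zero (by
          rintro rfl; rw [zero_dvd_iff] at hdvd; exact hK₁ hdvd)
        refine ⟨⟨hs0, ?_⟩, ?_, ?_, ?_⟩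
        · have hsK : s ≤ K₁ := Nat.le_of_dvd (Nat.pos_of_ne_zero hK₁) hdvd
          have h1' : (K₁ : ℤ) ≤ r * K₁ := by
            have : (1 : ℤ) ≤ r := by exact_mod_cast hr
            nlinarith
          have hS' : ((r * K₁ : ℕ) : ℤ) ≤ S := hS
          push_cast at hS'
          exact_mod_cast (show (s : ℤ) ≤ S by have := (Nat.cast_le (α := ℤ)).2 hsK; linarith)
        · rw [mul_comm s r]; exact (Nat.mul_dvd_mul_iff_left hr).2 hdvd
        · nlinarith
        · nlinarith
    rw [hL, hR]
    exact card_Ioc_floor_filter_dvd_eq_card_switch hK₁ hP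
  · have hL : (Ioc ⌊P⌋₊ ⌊P'⌋₊).filter (fun q : ℕ => ((q * r : ℕ) : ℤ) ∣ (K : ℤ)) = ∅ := by
      refine Finset.filter_eq_empty_iff.2 fun q _ h => hrK ?_
      rw [Int.natCast_dvd_natCast] at h
      exact Nat.dvd_trans (Nat.dvd_mul_left r q) h
    have hR : (Icc 1 S).filter (fun s : ℕ => ((s * r : ℕ) : ℤ) ∣ (K : ℤ) ∧
        P * r * s < ((K : ℤ) : ℝ) ∧ ((K : ℤ) : ℝ) ≤ P' * r * s) = ∅ := by
      refine Finset.filter_eq_empty_iff.2 fun s _ h => hrK ?_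
      have h' := h.1
      rw [Int.natCast_dvd_natCast] at h'
      exact Nat.dvd_trans (Nat.dvd_mul_left r s) h'
    rw [hL, hR]

/-! ### The switch for weighted sums over `n` -/

/-- **The `q ↔ s` switch for a weighted sum over `n`** (the complementary divisor
`s = (n − a)/(qr)`): for `r ≥ 1`, real `0 ≤ P ≤ P'`, a finite set `T` of `n` with `n > a` and
`n − a ≤ S` on `T`, any weight `w` and any condition `c`,
`∑_{⌊P⌋ < q ≤ ⌊P'⌋} ∑_{n ∈ T, c(n), qr ∣ n−a} w(n)
  = ∑_{s ≤ S} ∑_{n ∈ T, c(n), sr ∣ n−a, P r s < n − a ≤ P' r s} w(n)`.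
[cite: BombieriFriedlanderIwaniecActa1986, §13 p. 241–242] -/
theorem switch_sum_eq (a : ℤ) {r : ℕ} (hr : 0 < r) {P P' : ℝ} (hP : 0 ≤ P) (T : Finset ℕ)
    (c : ℕ → Prop) [DecidablePred c] (w : ℕ → ℝ) {S : ℕ} (hpos : ∀ n ∈ T, a < (n : ℤ))
    (hS : ∀ n ∈ T, (n : ℤ) - a ≤ S) :
    ∑ q ∈ Ioc ⌊P⌋₊ ⌊P'⌋₊, ∑ n ∈ T, (if c n ∧ ((q * r : ℕ) : ℤ) ∣ (n : ℤ) - a then w n else 0) =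
      ∑ s ∈ Icc 1 S, ∑ n ∈ T,
        (if c n ∧ ((s * r : ℕ) : ℤ) ∣ (n : ℤ) - a ∧ P * r * s < ((n : ℤ) - a : ℤ) ∧
            (((n : ℤ) - a : ℤ) : ℝ) ≤ P' * r * s then w n else 0) := by
  rw [Finset.sum_comm]
  conv_rhs => rw [Finset.sum_comm]
  refine Finset.sum_congr rfl fun n hn => ?_
  by_cases hc : c n
  · set K : ℤ := (n : ℤ) - a with hK
    have hK0 : 0 < K := by rw [hK]; linarith [hpos n hn]
    have h1 : ∑ q ∈ Ioc ⌊P⌋₊ ⌊P'⌋₊, (if c n ∧ ((q * r : ℕ) : ℤ) ∣ K then w n else 0) =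
        w n * ∑ q ∈ Ioc ⌊P⌋₊ ⌊P'⌋₊, (if ((q * r : ℕ) : ℤ) ∣ K then (1 : ℝ) else 0) := by
      rw [Finset.mul_sum]
      refine Finset.sum_congr rfl fun q _ => ?_
      by_cases hd : ((q * r : ℕ) : ℤ) ∣ K
      · rw [if_pos ⟨hc, hd⟩, if_pos hd, mul_one]
      · rw [if_neg (fun h => hd h.2), if_neg hd, mul_zero]
    have h2 : ∑ s ∈ Icc 1 S, (if c n ∧ ((s * r : ℕ) : ℤ) ∣ K ∧ P * r * s < (K : ℝ) ∧ (K : ℝ) ≤ P' * r * s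
          then w n else 0) =
        w n * ∑ s ∈ Icc 1 S, (if ((s * r : ℕ) : ℤ) ∣ K ∧ P * r * s < (K : ℝ) ∧ (K : ℝ) ≤ P' * r * s
          then (1 : ℝ) else 0) := by
      rw [Finset.mul_sum]
      refine Finset.sum_congr rfl fun s _ => ?_
      by_cases hd : ((s * r : ℕ) : ℤ) ∣ K ∧ P * r * s < (K : ℝ) ∧ (K : ℝ) ≤ P' * r * s
      · rw [if_pos ⟨hc, hd⟩, if_pos hd, mul_one]
      · rw [if_neg (fun h => hd h.2), if_neg hd, mul_zero]
    rw [h1, h2, sum_Ioc_floor_dvd_indicator_eq hK0 hr hP (hS n hn)]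
  · rw [Finset.sum_eq_zero fun q _ => if_neg (fun h => hc h.1),
      Finset.sum_eq_zero fun s _ => if_neg (fun h => hc h.1)]

/-- Sums over `[1, N]` and `[1, M]` of a function vanishing beyond both `N` and `M` agree. [folklore] -/
theorem sum_Icc_eq_of_vanish (f : ℕ → ℝ) {N M : ℕ} (hN : ∀ s, N < s → f s = 0)
    (hM : ∀ s, M < s → f s = 0) : ∑ s ∈ Icc 1 N, f s = ∑ s ∈ Icc 1 M, f s := by
  wlog hle : N ≤ M generalizing N M
  · exact (this hM hN (le_of_not_ge hle)).symm
  refine Finset.sum_subset (Finset.Icc_subset_Icc_right hle) fun s hs hs' => ?_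
  rw [Finset.mem_Icc] at hs hs'
  exact hN s (by omega)

/-- **The switch with the natural range of `s`**: as `BFI.switch_sum_eq`, but the sum over `s` cut
at any `S'` beyond which the strip condition is void: if `0 < P` and `n − a ≤ P r (S' + 1)` on `T`,
then the switched sum may be taken over `s ≤ S'`. [cite: BombieriFriedlanderIwaniecActa1986, §13 p. 241–242] -/
theorem switch_sum_eq' (a : ℤ) {r : ℕ} (hr : 0 < r) {P P' : ℝ} (hP : 0 < P) (T : Finset ℕ)
    (c : ℕ → Prop) [DecidablePred c] (w : ℕ → ℝ) {S' : ℕ} (hpos : ∀ n ∈ T, a < (n : ℤ))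
    (hS' : ∀ n ∈ T, (((n : ℤ) - a : ℤ) : ℝ) ≤ P * r * ((S' : ℝ) + 1)) :
    ∑ q ∈ Ioc ⌊P⌋₊ ⌊P'⌋₊, ∑ n ∈ T, (if c n ∧ ((q * r : ℕ) : ℤ) ∣ (n : ℤ) - a then w n else 0) =
      ∑ s ∈ Icc 1 S', ∑ n ∈ T,
        (if c n ∧ ((s * r : ℕ) : ℤ) ∣ (n : ℤ) - a ∧ P * r * s < ((n : ℤ) - a : ℤ) ∧
            (((n : ℤ) - a : ℤ) : ℝ) ≤ P' * r * s then w n else 0) := by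
  classical
  -- a crude common bound `S` for `n - a` on `T`
  obtain ⟨S, hS⟩ : ∃ S : ℕ, ∀ n ∈ T, (n : ℤ) - a ≤ S := by
    refine ⟨T.sup id + a.natAbs, fun n hn => ?_⟩
    have h1 : n ≤ T.sup id := Finset.le_sup (f := id) hn
    have h2 : -a ≤ (a.natAbs : ℤ) := by have := Int.le_natAbs (a := -a); rwa [Int.natAbs_neg] at this
    have h1' : (n : ℤ) ≤ (T.sup id : ℕ) := by exact_mod_cast h1
    rw [Nat.cast_add, Int.natCast_natAbs]
    have h3 : (a.natAbs : ℤ) = |a| := Int.natCast_natAbs a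
    rw [h3] at h2
    linarith
  rw [switch_sum_eq a hr hP.le T c w hpos hS]
  refine sum_Icc_eq_of_vanish _ (fun s hs => ?_) (fun s hs => ?_)
  · -- `s > S`: `sr ∣ n - a` with `0 < n - a ≤ S < s ≤ sr` is impossible
    refine Finset.sum_eq_zero fun n hn => if_neg ?_
    rintro ⟨-, hdvd, -, -⟩
    have hK : 0 < (n : ℤ) - a := by linarith [hpos n hn]
    have hle := Int.le_of_dvd hK hdvd
    have hS1 := hS n hn
    have : (s : ℤ) ≤ (s * r : ℕ) := by
      push_cast; have : (1 : ℤ) ≤ r := by exact_mod_cast hr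
      nlinarith
    have : (S : ℤ) < s := by exact_mod_cast hs
    linarith
  · -- `s > S'`: `P r s ≥ P r (S' + 1) ≥ n - a` contradicts the strip
    refine Finset.sum_eq_zero fun n hn => if_neg ?_
    rintro ⟨-, -, hlt, -⟩
    have hrr : (0 : ℝ) < r := by exact_mod_cast hr
    have hs1 : (S' : ℝ) + 1 ≤ s := by exact_mod_cast hs
    have : P * r * ((S' : ℝ) + 1) ≤ P * r * s := mul_le_mul_of_nonneg_left hs1 (by positivity)
    linarith [hS' n hn]

/-! ### Residue classes in an interval -/

/-- **Upper count**: for `d ≥ 1`, integers `A ≤ B` and any `a`,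
`#{A < n ≤ B : d ∣ n − a} ≤ (B − A)/d + 1`. [folklore] -/
theorem card_Ioc_filter_intCast_dvd_sub_le {d : ℕ} (hd : 0 < d) (a : ℤ) {A B : ℕ} (hAB : A ≤ B) :
    (((Ioc A B).filter (fun n : ℕ => (d : ℤ) ∣ (n : ℤ) - a)).card : ℝ) ≤ ((B : ℝ) - A) / d + 1 := by
  set T := (Ioc A B).filter (fun n : ℕ => (d : ℤ) ∣ (n : ℤ) - a) with hT
  -- the map `n ↦ (n - (A+1)) / d` is injective on `T` with values `< (B - A - 1)/d + 1`
  have hdr : (0 : ℝ) < d := by exact_mod_cast hd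
  rcases Finset.eq_empty_or_nonempty T with hTe | hTne
  · rw [hTe, Finset.card_empty, Nat.cast_zero]
    have : (0 : ℝ) ≤ ((B : ℝ) - A) / d := div_nonneg (by
      have : (A : ℝ) ≤ B := by exact_mod_cast hAB
      linarith) hdr.le
    linarith
  have hAB' : A < B := by
    obtain ⟨n, hn⟩ := hTne
    have := Finset.mem_Ioc.1 (Finset.mem_filter.1 hn).1
    omega
  set f : ℕ → ℕ := fun n => (n - (A + 1)) / d with hf
  have hinj : Set.InjOn f (T : Set ℕ) := by
    intro n₁ h₁ n₂ h₂ h12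
    rw [Finset.mem_coe, hT, Finset.mem_filter, Finset.mem_Ioc] at h₁ h₂
    -- `d ∣ n₁ - n₂`
    have hdvd : (d : ℤ) ∣ (n₁ : ℤ) - n₂ := by
      have := dvd_sub h₁.2 h₂.2
      rwa [sub_sub_sub_cancel_right] at this
    by_contra hne
    rcases lt_or_gt_of_ne hne with hlt | hlt
    · -- `n₁ < n₂`, `n₂ - n₁ ≥ d`
      have hd' : d ∣ n₂ - n₁ := by
        have : (d : ℤ) ∣ (n₂ : ℤ) - n₁ := by
          have := hdvd.neg_right; rwa [neg_sub] at this
        rw [← Int.natCast_dvd_natCast]; push_cast [hlt.le]; exact this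
      have hge : d ≤ n₂ - n₁ := Nat.le_of_dvd (by omega) hd'
      have : f n₁ + 1 ≤ f n₂ := by
        simp only [hf]
        have e : n₂ - (A + 1) = (n₁ - (A + 1)) + (n₂ - n₁) := by omega
        rw [e]
        calc (n₁ - (A + 1)) / d + 1 = ((n₁ - (A + 1)) + d) / d := by
              rw [Nat.add_div_right _ hd]
          _ ≤ ((n₁ - (A + 1)) + (n₂ - n₁)) / d := Nat.div_le_div_right (by omega)
      omega
    · have hd' : d ∣ n₁ - n₂ := by
        rw [← Int.natCast_dvd_natCast]; push_cast [hlt.le]; exact hdvd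
      have hge : d ≤ n₁ - n₂ := Nat.le_of_dvd (by omega) hd'
      have : f n₂ + 1 ≤ f n₁ := by
        simp only [hf]
        have e : n₁ - (A + 1) = (n₂ - (A + 1)) + (n₁ - n₂) := by omega
        rw [e]
        calc (n₂ - (A + 1)) / d + 1 = ((n₂ - (A + 1)) + d) / d := by
              rw [Nat.add_div_right _ hd]
          _ ≤ ((n₂ - (A + 1)) + (n₁ - n₂)) / d := Nat.div_le_div_right (by omega)
      omega
  have himage : T.image f ⊆ Finset.range ((B - (A + 1)) / d + 1) := by
    intro k hk
    rw [Finset.mem_image] at hk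
    obtain ⟨n, hn, rfl⟩ := hk
    rw [hT, Finset.mem_filter, Finset.mem_Ioc] at hn
    rw [Finset.mem_range, Nat.lt_succ_iff]
    exact Nat.div_le_div_right (by omega)
  have hcard : T.card ≤ (B - (A + 1)) / d + 1 := by
    calc T.card = (T.image f).card := (Finset.card_image_of_injOn hinj).symm
      _ ≤ (Finset.range ((B - (A + 1)) / d + 1)).card := Finset.card_le_card himage
      _ = (B - (A + 1)) / d + 1 := Finset.card_range _
  have h1 : (((B - (A + 1)) / d : ℕ) : ℝ) ≤ ((B : ℝ) - A) / d := by
    rw [le_div_iff₀ hdr]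
    have h2 : (((B - (A + 1)) / d : ℕ) : ℝ) * d ≤ ((B - (A + 1) : ℕ) : ℝ) := by
      exact_mod_cast Nat.div_mul_le_self _ _
    have h3 : ((B - (A + 1) : ℕ) : ℝ) ≤ (B : ℝ) - A := by
      rw [Nat.cast_sub (by omega)]; push_cast; linarith
    linarith
  calc (T.card : ℝ) ≤ (((B - (A + 1)) / d + 1 : ℕ) : ℝ) := by exact_mod_cast hcard
    _ = (((B - (A + 1)) / d : ℕ) : ℝ) + 1 := by push_cast; ring
    _ ≤ ((B : ℝ) - A) / d + 1 := by linarith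

/-- **Lower count**: for `d ≥ 1`, integers `A ≤ B` and any `a`,
`(B − A)/d − 1 ≤ #{A < n ≤ B : d ∣ n − a}`: the multiples `n = n₀ + d j` of one admissible
`n₀ ∈ (A, A + d]` with `n ≤ B` are all counted. [folklore] -/
theorem card_Ioc_filter_intCast_dvd_sub_ge {d : ℕ} (hd : 0 < d) (a : ℤ) (A B : ℕ) :
    ((B : ℝ) - A) / d - 1 ≤ (((Ioc A B).filter (fun n : ℕ => (d : ℤ) ∣ (n : ℤ) - a)).card : ℝ) := by
  have hdr : (0 : ℝ) < d := by exact_mod_cast hd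
  -- the first admissible integer above `A`: `n₀ = A + 1 + ((a - (A+1)) mod d)`
  set x : ℤ := a - ((A + 1 : ℕ) : ℤ) with hx
  have hd0 : (d : ℤ) ≠ 0 := by exact_mod_cast hd.ne'
  have h0 : 0 ≤ x % (d : ℤ) := Int.emod_nonneg _ hd0
  have h1 : x % (d : ℤ) < d := Int.emod_lt_of_pos _ (by exact_mod_cast hd)
  set t : ℕ := (x % (d : ℤ)).toNat with ht
  have htx : (t : ℤ) = x % (d : ℤ) := Int.toNat_of_nonneg h0
  have ht_lt : t < d := by
    have : (t : ℤ) < d := by rw [htx]; exact h1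
    exact_mod_cast this
  have ht_dvd : (d : ℤ) ∣ ((A + 1 + t : ℕ) : ℤ) - a := by
    have e : ((A + 1 + t : ℕ) : ℤ) - a = -(x - x % (d : ℤ)) := by
      push_cast; rw [htx, hx]; push_cast; ring
    have e2 : x - x % (d : ℤ) = d * (x / d) := by rw [Int.emod_def]; ring
    rw [e, e2, dvd_neg]
    exact dvd_mul_right _ _
  -- the multiples `n₀ + d j`, `j < J`, with `J = (B - A - t) / d`... we count `j` with `n₀ + d j ≤ B`
  set n₀ : ℕ := A + 1 + t with hn₀
  by_cases hB : B < n₀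
  · -- then `(B - A)/d - 1 < 0 ≤ card`
    have hBA : (B : ℝ) - A < d := by
      have h' : B < A + d := by omega
      have : (B : ℝ) < A + d := by exact_mod_cast h'
      linarith
    have : ((B : ℝ) - A) / d - 1 < 0 := by rw [sub_neg, div_lt_one hdr]; exact hBA
    have h0' : (0 : ℝ) ≤ (((Ioc A B).filter (fun n : ℕ => (d : ℤ) ∣ (n : ℤ) - a)).card : ℝ) := Nat.cast_nonneg _
    linarith
  push Not at hB
  set J : ℕ := (B - n₀) / d + 1 with hJ
  have hsub : (Finset.range J).image (fun j => n₀ + d * j) ⊆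
      (Ioc A B).filter (fun n : ℕ => (d : ℤ) ∣ (n : ℤ) - a) := by
    intro n hn
    rw [Finset.mem_image] at hn
    obtain ⟨j, hj, rfl⟩ := hn
    rw [Finset.mem_range, hJ, Nat.lt_succ_iff] at hj
    rw [Finset.mem_filter, Finset.mem_Ioc]
    refine ⟨⟨by omega, ?_⟩, ?_⟩
    · have : d * j ≤ B - n₀ := by
        calc d * j ≤ d * ((B - n₀) / d) := Nat.mul_le_mul_left d hj
          _ ≤ B - n₀ := Nat.mul_div_le _ _
      omega
    · have e : ((n₀ + d * j : ℕ) : ℤ) - a = (((n₀ : ℕ) : ℤ) - a) + d * j := by push_cast; ring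
      rw [e]
      exact dvd_add ht_dvd (dvd_mul_right _ _)
  have hinj : Function.Injective (fun j : ℕ => n₀ + d * j) := by
    intro j₁ j₂ h
    have : d * j₁ = d * j₂ := by simpa using h
    exact Nat.eq_of_mul_eq_mul_left hd this
  have hcard : J ≤ ((Ioc A B).filter (fun n : ℕ => (d : ℤ) ∣ (n : ℤ) - a)).card := by
    calc J = ((Finset.range J).image (fun j => n₀ + d * j)).card := by
          rw [Finset.card_image_of_injective _ hinj, Finset.card_range]
      _ ≤ _ := Finset.card_le_card hsub
  -- `J ≥ (B - A)/d - 1`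
  have hJge : ((B : ℝ) - A) / d - 1 ≤ J := by
    have hm : ((B - n₀ : ℕ) : ℝ) < (((B - n₀) / d : ℕ) : ℝ) * d + d := by
      exact_mod_cast Nat.lt_div_mul_add hd
    have hBn : ((B - n₀ : ℕ) : ℝ) = (B : ℝ) - n₀ := by rw [Nat.cast_sub hB]
    have hn₀le : n₀ ≤ A + d := by omega
    have hn₀r : (n₀ : ℝ) ≤ A + d := by exact_mod_cast hn₀le
    have hJr : (J : ℝ) = (((B - n₀) / d : ℕ) : ℝ) + 1 := by rw [hJ]; push_cast; ring
    rw [hJr]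
    rw [hBn] at hm
    have h1 : ((B : ℝ) - n₀) / d - 1 < (((B - n₀) / d : ℕ) : ℝ) := by
      rw [div_sub_one hdr.ne', div_lt_iff₀ hdr]; linarith
    have h2 : ((B : ℝ) - A) / d - 1 ≤ ((B : ℝ) - n₀) / d := by
      rw [div_sub_one hdr.ne', div_le_div_iff_of_pos_right hdr]; linarith
    linarith
  calc ((B : ℝ) - A) / d - 1 ≤ J := hJge
    _ ≤ _ := by exact_mod_cast hcard

/-! ### Blocks of ratio `λ` -/

/-- Peeling the top block: for `0 ≤ X' ≤ X`,
`∑_{1 ≤ n ≤ X} f(n) = ∑_{1 ≤ n ≤ X'} f(n) + ∑_{X' < n ≤ X} f(n)`. [folklore] -/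
theorem sum_Icc_floor_eq_add_sum_Ioc (f : ℕ → ℝ) {X' X : ℝ} (hXX : X' ≤ X) :
    ∑ n ∈ Icc 1 ⌊X⌋₊, f n = (∑ n ∈ Icc 1 ⌊X'⌋₊, f n) + ∑ n ∈ Ioc ⌊X'⌋₊ ⌊X⌋₊, f n := by
  have h1 : ∀ N : ℕ, Icc 1 N = Ioc 0 N := fun N => by ext n; simp [Nat.one_le_iff_ne_zero, Nat.pos_iff_ne_zero]
  rw [h1, h1]
  exact (Finset.sum_Ioc_consecutive f (Nat.zero_le _) (Nat.floor_le_floor hXX)).symm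

/-- **Subdivision into blocks of ratio `λ`**: for `λ ≥ 1`, `X ≥ 0` and `X/λ^M < 1`,
`∑_{1 ≤ n ≤ X} f(n) = ∑_{i<M} ∑_{X/λ^{i+1} < n ≤ X/λ^i} f(n)`.
[cite: BombieriFriedlanderIwaniecActa1986, §13 p. 242 ("by a subdivision argument")] -/
theorem sum_Icc_floor_eq_sum_geomBlocks (f : ℕ → ℝ) {X lam : ℝ} (hX : 0 ≤ X) (hlam : 1 ≤ lam) {M : ℕ}
    (hM : X / lam ^ M < 1) :
    ∑ n ∈ Icc 1 ⌊X⌋₊, f n =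
      ∑ i ∈ Finset.range M, ∑ n ∈ Ioc ⌊X / lam ^ (i + 1)⌋₊ ⌊X / lam ^ i⌋₊, f n := by
  have hlam0 : 0 < lam := by linarith
  have htel : ∀ K : ℕ, ∑ n ∈ Icc 1 ⌊X⌋₊, f n =
      (∑ n ∈ Icc 1 ⌊X / lam ^ K⌋₊, f n) +
        ∑ i ∈ Finset.range K, ∑ n ∈ Ioc ⌊X / lam ^ (i + 1)⌋₊ ⌊X / lam ^ i⌋₊, f n := by
    intro K
    induction K with
    | zero => simp
    | succ K ih =>
      rw [Finset.sum_range_succ, ih]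
      have hsplit := sum_Icc_floor_eq_add_sum_Ioc f (X' := X / lam ^ (K + 1)) (X := X / lam ^ K)
        (by rw [pow_succ]
            exact div_le_div_of_nonneg_left hX (by positivity) (le_mul_of_one_le_right (by positivity) hlam))
      rw [hsplit]
      ring
  rw [htel M]
  have h0 : ⌊X / lam ^ M⌋₊ = 0 := Nat.floor_eq_zero.2 hM
  rw [h0]
  simp

/-- `log(1 + η) ≥ η/2` for `0 ≤ η ≤ 1`. [folklore] -/
theorem half_le_log_one_add {η : ℝ} (hη0 : 0 ≤ η) (hη1 : η ≤ 1) : η / 2 ≤ Real.log (1 + η) := by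
  -- `log(1+η) ≥ 1 − 1/(1+η) = η/(1+η) ≥ η/2`
  have h := Real.one_sub_inv_le_log_of_pos (x := 1 + η) (by linarith)
  have e : 1 - (1 + η)⁻¹ = η / (1 + η) := by field_simp; ring
  rw [e] at h
  have h2 : η / 2 ≤ η / (1 + η) := by
    rw [div_le_div_iff₀ (by norm_num) (by linarith)]; nlinarith
  linarith

/-- **The number of blocks**: for `X ≥ 1` and `λ > 1` there is `M` with `X/λ^M < 1`, `X/λ^M ≥ 1/λ`
(the last block is not below `1/λ`) and `M ≤ log X / log λ + 1`. [folklore] -/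
theorem exists_geomBlocks {X lam : ℝ} (hX : 1 ≤ X) (hlam : 1 < lam) :
    ∃ M : ℕ, X / lam ^ M < 1 ∧ 1 / lam ≤ X / lam ^ M ∧ (M : ℝ) ≤ Real.log X / Real.log lam + 1 := by
  have hlam0 : 0 < lam := by linarith
  have hlog : 0 < Real.log lam := Real.log_pos hlam
  have hX0 : 0 < X := by linarith
  set t : ℝ := Real.log X / Real.log lam with ht
  have ht0 : 0 ≤ t := div_nonneg (Real.log_nonneg hX) hlog.le
  refine ⟨⌊t⌋₊ + 1, ?_, ?_, ?_⟩
  · -- `lam^(⌊t⌋+1) > lam^t = X`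
    rw [div_lt_one (by positivity)]
    have h1 : X = lam ^ t := by
      rw [ht, Real.rpow_def_of_pos hlam0]
      field_simp
      exact (Real.exp_log hX0).symm
    have h2 : lam ^ t < lam ^ ((⌊t⌋₊ + 1 : ℕ) : ℝ) := by
      refine Real.rpow_lt_rpow_of_exponent_lt hlam ?_
      push_cast
      exact Nat.lt_floor_add_one t
    rw [Real.rpow_natCast] at h2
    linarith
  · -- `lam^⌊t⌋ ≤ lam^t = X`
    rw [div_le_div_iff₀ hlam0 (by positivity), one_mul, pow_succ]
    refine mul_le_mul_of_nonneg_right ?_ hlam0.le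
    have h1 : X = lam ^ t := by
      rw [ht, Real.rpow_def_of_pos hlam0]
      field_simp
      exact (Real.exp_log hX0).symm
    have h2 : lam ^ ((⌊t⌋₊ : ℕ) : ℝ) ≤ lam ^ t :=
      Real.rpow_le_rpow_of_exponent_le hlam.le (Nat.floor_le ht0)
    rw [Real.rpow_natCast] at h2
    linarith
  · push_cast
    linarith [Nat.floor_le ht0]


end BFI

end Literature.NumberTheory.Sieve
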